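import Mathlib.Data.Fintype.Basic
import Mathlib.Data.Fintype.Sum
import Mathlib.Data.Fintype.Prod
import Mathlib.Data.List.FinRange
import Literature.Computability.Complexity.CNF
import HarnessLib

/-!
# The index-gadget lift of a CNF

The standard "lifting by indexing" substitution of proof complexity (Garg–Göös–Kamath–Sokolov
2018, §1–2, dag-like lifting with the `m`-ary index gadget `IND_m : [m] × {0,1}^m → {0,1}`,
`IND_m(x, y) = y_x`): every variable ("block") `e` of a CNF `φ` over `E` is replaced by a
POINTER `x_e ∈ [m]`, written in one-hot Boolean form with pointer bits `x_{e,α}`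
(`Sum.inl (e, α)`), and a row of CELLS `y_{e,α}` (`Sum.inr (e, α)`), the intended value of `e`
being the pointed cell `y_{e,x_e}`.  The lifted CNF `indexLift m φ` consists of the one-hot
axioms (`atLeastOne`, `atMostOne`) and, for every clause `C` of `φ` and every choice `α` of
pointer values on the literal occurrences of `C`, the clause
`⋁_{(e,b) ∈ C} (¬ x_{e,α_e} ∨ y_{e,α_e}^b)` (`liftClause`).  No auxiliary ("helper") bits.
Proved here: the lift of an unsatisfiable CNF is unsatisfiable
(`not_satisfiable_indexLift`), via the aimed sub-clause `aimedClause`.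

## References
* A. Garg, M. Göös, P. Kamath, D. Sokolov, *Monotone circuit lower bounds from resolution*,
  STOC 2018, §1–2 (index gadget, lifted CNF `F ∘ IND_m^n`) [GargEtAl2018].

Not here: the converse (satisfiable stays satisfiable, `m ≥ 1`), size bookkeeping, any lifting
theorem.
-/

namespace Literature.Computability.MetaComplexity

open Literature.Computability.Complexity

/-- Variables of the `m`-ary index-gadget lift of a CNF over blocks `E`: pointer bits
`x_{e,α}` are `Sum.inl (e, α)`, cells `y_{e,α}` are `Sum.inr (e, α)` (`α : Fin m`).
[cite: GargEtAl2018, §2] -/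
abbrev LiftVar (E : Type*) (m : ℕ) := (E × Fin m) ⊕ (E × Fin m)

namespace IndexLift

variable {E : Type*} (m : ℕ)

/-- The lift of one clause: for every choice of pointer values on its literal occurrences, the
clause `⋁_{(e,b) ∈ C} (¬ x_{e,α_e} ∨ y_{e,α_e}^b)`. [cite: GargEtAl2018, §2] -/
def liftClause : Clause E → List (Clause (LiftVar E m))
  | [] => [[]]
  | (e, b) :: C => (List.finRange m).flatMap fun α =>
      (liftClause C).map fun D => (Sum.inl (e, α), false) :: (Sum.inr (e, α), b) :: D

/-- The at-least-one pointer axiom of block `e`: `x_{e,0} ∨ ⋯ ∨ x_{e,m-1}`.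
[cite: GargEtAl2018, §2] -/
def atLeastOne (e : E) : Clause (LiftVar E m) :=
  (List.finRange m).map fun α => (Sum.inl (e, α), true)

/-- The at-most-one pointer axioms of block `e`: `¬ x_{e,α} ∨ ¬ x_{e,β}` for `α < β`.
[cite: GargEtAl2018, §2] -/
def atMostOne (e : E) : List (Clause (LiftVar E m)) :=
  (List.finRange m).flatMap fun α =>
    ((List.finRange m).filter fun β => α < β).map fun β =>
      [(Sum.inl (e, α), false), (Sum.inl (e, β), false)]

/-- The member of `liftClause m C` AIMED at the pointer vector `α`:
`⋁_{(e,b) ∈ C} (¬ x_{e,α e} ∨ y_{e,α e}^b)`. [cite: GargEtAl2018, §2] -/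
def aimedClause (α : E → Fin m) : Clause E → Clause (LiftVar E m)
  | [] => []
  | (e, b) :: C => (Sum.inl (e, α e), false) :: (Sum.inr (e, α e), b) :: aimedClause α C

/-- The aimed clause is one of the lifted copies. [cite: GargEtAl2018, §2] -/
theorem aimedClause_mem_liftClause (α : E → Fin m) :
    ∀ C : Clause E, aimedClause m α C ∈ liftClause m C
  | [] => by simp [aimedClause, liftClause]
  | (e, b) :: C => by
      simp only [aimedClause, liftClause, List.mem_flatMap, List.mem_finRange, true_and,
        List.mem_map]
      exact ⟨α e, aimedClause m α C, aimedClause_mem_liftClause α C, rfl⟩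

/-- Reading a base assignment off a lifted one along pointers `α`: `z e := y_{e, α e}`.
[cite: GargEtAl2018, §2] -/
def readOff (α : E → Fin m) (τ : LiftVar E m → Bool) : E → Bool :=
  fun e => τ (Sum.inr (e, α e))

/-- If the pointer bits `x_{e,α e}` are all on and the aimed copy of `C` is true at `τ`, then
`C` is true at the read-off assignment. [cite: GargEtAl2018, §2] -/
theorem eval_of_aimedClause_eval (α : E → Fin m) (τ : LiftVar E m → Bool)
    (hx : ∀ e, τ (Sum.inl (e, α e)) = true) :
    ∀ C : Clause E, (aimedClause m α C).eval τ = true → C.eval (readOff m α τ) = true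
  | [] => by simp [aimedClause, Clause.eval]
  | (e, b) :: C => by
      intro h
      have ih := eval_of_aimedClause_eval α τ hx C
      change (Literal.eval τ (Sum.inl (e, α e), false) ||
        (Literal.eval τ (Sum.inr (e, α e), b) || (aimedClause m α C).any (Literal.eval τ))) =
          true at h
      change (Literal.eval (readOff m α τ) (e, b) || C.any (Literal.eval (readOff m α τ))) = true
      rw [Bool.or_eq_true, Bool.or_eq_true] at h
      rw [Bool.or_eq_true]
      rcases h with h | h | h
      · simp [Literal.eval, hx] at h
      · exact Or.inl (by simpa [Literal.eval, readOff] using h)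
      · exact Or.inr (ih h)

end IndexLift

open IndexLift in
/-- The `m`-ary index-gadget lift `φ ∘ IND_m` of a CNF `φ` over a finite type of blocks `E`:
one-hot pointer axioms for every block, and every lifted copy of every clause.
[cite: GargEtAl2018, §2] -/
noncomputable def indexLift {E : Type*} [Fintype E] (m : ℕ) (φ : CNF E) : CNF (LiftVar E m) :=
  ((Finset.univ : Finset E).toList.map (atLeastOne m)) ++
    ((Finset.univ : Finset E).toList.flatMap (atMostOne m)) ++
    φ.flatMap (liftClause m)

open IndexLift in
/-- The lift of an unsatisfiable CNF is unsatisfiable: from a satisfying assignment of the lift,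
the at-least-one axioms give a pointer value `α e` with `x_{e,α e} = 1` for every block, and the
read-off assignment `e ↦ y_{e,α e}` satisfies `φ` because every aimed copy of every clause is
satisfied. [cite: GargEtAl2018, §2] -/
theorem not_satisfiable_indexLift {E : Type*} [Fintype E] (m : ℕ) {φ : CNF E}
    (hφ : ¬ φ.Satisfiable) : ¬ (indexLift m φ).Satisfiable := by
  rintro ⟨τ, hτ⟩
  rw [CNF.eval_eq_true_iff] at hτ
  -- a lit pointer bit in every block
  have hptr : ∀ e : E, ∃ α : Fin m, τ (Sum.inl (e, α)) = true := by
    intro e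
    have hmem : atLeastOne m e ∈ indexLift m φ := by
      simp [indexLift, List.mem_append, List.mem_map, Finset.mem_toList]
    have h := hτ _ hmem
    simp only [atLeastOne, Clause.eval, List.any_map, List.any_eq_true, List.mem_finRange,
      Function.comp, Literal.eval, true_and] at h
    obtain ⟨α, hα⟩ := h
    exact ⟨α, by simpa using hα⟩
  choose α hα using hptr
  refine hφ ⟨readOff m α τ, ?_⟩
  rw [CNF.eval_eq_true_iff]
  intro C hC
  refine eval_of_aimedClause_eval m α τ hα C (hτ _ ?_)
  have : aimedClause m α C ∈ φ.flatMap (liftClause m) :=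
    List.mem_flatMap.2 ⟨C, hC, aimedClause_mem_liftClause m α C⟩
  simp [indexLift, List.mem_append, this]

end Literature.Computability.MetaComplexity
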